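import Summits.Ventures.PercRepro.C025ProfileHallTop

/-!
# The disjoint BIJECTION on the independent sets of a finite matroid (night-3 g7)

`exists_disjoint_bijOn_indepFinsets`: every finite matroid `N` has a map `φ` that is a BIJECTION of its set of
independent sets onto itself with `φ B` disjoint from `B` for every independent `B` — the injective map of
`exists_disjoint_injOn_indepFinsets` (C025ProfileHallTop) is onto, the set being finite (`Finset.surjOn_of_injOn_of_card_le`).
On the free matroid it is complementation; in general it is the structural fact behind the top level of C-033 (H⁺).
-/

open scoped Matroid

namespace PercRepro

variable {α : Type} [DecidableEq α]

/-- **The disjoint bijection on the independent sets**: `φ` maps the independent sets of `N` bijectively onto the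
independent sets of `N`, with `φ B` disjoint from `B`. -/
theorem exists_disjoint_bijOn_indepFinsets (N : Matroid α) [N.Finite] :
    ∃ φ : Finset α → Finset α, (∀ B ∈ indepFinsets N, Disjoint B (φ B)) ∧
      Set.BijOn φ (indepFinsets N : Set (Finset α)) (indepFinsets N : Set (Finset α)) := by
  obtain ⟨φ, hφ, hinj⟩ := exists_disjoint_injOn_indepFinsets N
  have hmaps : Set.MapsTo φ (indepFinsets N : Set (Finset α)) (indepFinsets N : Set (Finset α)) := by
    intro B hB
    rw [Finset.mem_coe] at hB ⊢
    exact (hφ B hB).1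
  refine ⟨φ, fun B hB => (hφ B hB).2, hmaps, hinj, ?_⟩
  exact Finset.surjOn_of_injOn_of_card_le φ hmaps hinj le_rfl

end PercRepro
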